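import Literature.NumberTheory.Sieve.LinearEquationsInPrimesRelativeInverse
import Literature.NumberTheory.Sieve.LinearEquationsInPrimesFourierU2
import Mathlib.Analysis.Fourier.AddCircle
import HarnessLib

/-!
# `GI(1)`: the inverse theorem for the `U²[N]` norm (Green–Tao 2010, Conj. 8.3 at `s = 1`)

Trunk T-SIEVE (`Literature/NumberTheory/Sieve`). Part of the decomposition of
`Literature.NumberTheory.Sieve.GreenTao2010_gowersUniformity` (B. Green, T. Tao, *Linear equations
in primes*, Ann. of Math. 171 (2010), Thm. 7.2). After `LinearEquationsInPrimesRelativeInverse.lean`,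
Thm. 7.2 rests on `GI(s)`, Cor. 11.6 and Prop. 10.2. This file PROVES the first of these at
level `s = 1` ("The case `s = 1` is an exercise in harmonic analysis. Indeed in this case one can
take `G/Γ` to just be the standard unit circle `ℝ/ℤ`", §8):

* `Literature.NumberTheory.Sieve.GreenTao2010_inverseConjectureAt_one` — **`GI(1)`**:
  `GreenTao2010_inverseConjectureAt 1 δ` for every `δ > 0`, with the one-member family `{ℝ/ℤ}`
  (`Literature.NumberTheory.Sieve.Nilmanifold.circle`), the generator `cos(2π·)`
  (`Literature.NumberTheory.Sieve.cosCircle`, `1`-bounded with Lipschitz constant `2π` for the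
  quotient metric, `isBoundedLipschitz_cosCircle`) and `c = δ²/32`. Proof: embed `[N]` in `ℤ_{2N}`
  and compare norms (Lemma B.5, `uniformityNorm_pow_le_gowersPower_extendByZero`), extract a Fourier
  coefficient `|f̂(ξ)| > δ²/32` from `‖·‖_{U²}^4 = ∑|f̂|⁴ ≤ (sup|f̂|)² 𝔼 f²` (the sibling file
  `LinearEquationsInPrimesFourierU2.lean`; `exists_dftCoeff_gt`), rewrite it as an exponential sum
  over `[N]` (`sum_extendByZero_mul`), and correlate `f` with the rotation nilsequences
  `cos(2πnα)`, `sin(2πnα) = cos(2π(nα - ¼))` (`nilsequence_cosCircle`);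
* `Literature.NumberTheory.Sieve.GreenTao2010_relativeInverseAt_one_of` — hence **Prop. 10.1 at
  `s = 1`** needs Cor. 11.6 only for `2π`-Lipschitz functions on `ℝ/ℤ`; and
  `Literature.NumberTheory.Sieve.GreenTao2010_gowersUniformityAt_one_of` — **Thm. 7.2 at
  level `s = 1`** (`U²`-uniformity of `Λ'_{b,W} - 1`, which controls all systems of complexity `1`)
  follows from Cor. 11.6 and Prop. 10.2 at `s = 1` alone.

## References

* B. Green, T. Tao, *Linear equations in primes*, Ann. of Math. (2) 171 (2010), 1753–1850
  (arXiv:math/0606088), §8: Conj. 8.3 and the paragraph following it (the case `s = 1`); §10.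
  [cite: GreenTao2010, Conj. 8.3]
-/

noncomputable section

open Finset
open scoped BigOperators

namespace Literature.NumberTheory.Sieve

open Nilmanifold in
/-! ### `GI(1)`: the inverse theorem for the `U²[N]` norm via the circle nilmanifold -/

section inverseU2

/-- The cosine wave on the circle nilmanifold `ℝ/ℤ`: `y ↦ cos(2π y)` (the real part of the
character `e(y)`; well defined on `ℝ/ℤ`). [cite: GreenTao2010, §8 (after Conj. 8.3: "in this case
one can take `G/Γ` to just be the standard unit circle `ℝ/ℤ`")] -/
def cosCircle : Nilmanifold.circle.G ⧸ Nilmanifold.circle.Γ → ℝ :=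
  fun y => ((fourier 1 (show AddCircle (1 : ℝ) from y)) : ℂ).re

/-- The point `r + ℤ` of the circle nilmanifold. [folklore] -/
def circlePt (r : ℝ) : Nilmanifold.circle.G ⧸ Nilmanifold.circle.Γ :=
  QuotientGroup.mk (Multiplicative.ofAdd r)

/-- `cosCircle (r + ℤ) = cos(2π r)`. [folklore] -/
theorem cosCircle_circlePt (r : ℝ) : cosCircle (circlePt r) = Real.cos (2 * Real.pi * r) := by
  show ((fourier 1 ((r : ℝ) : AddCircle (1 : ℝ))) : ℂ).re = _
  rw [fourier_coe_apply]
  have : (2 * (Real.pi : ℂ) * Complex.I * ((1 : ℤ) : ℂ) * (r : ℂ) / ((1 : ℝ) : ℂ)) =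
      ((2 * Real.pi * r : ℝ) : ℂ) * Complex.I := by push_cast; ring
  rw [this, Complex.exp_ofReal_mul_I_re]

/-- Every point of the circle nilmanifold is `r + ℤ` for some real `r`. [folklore] -/
theorem exists_eq_circlePt (y : Nilmanifold.circle.G ⧸ Nilmanifold.circle.Γ) :
    ∃ r : ℝ, y = circlePt r := by
  induction y using QuotientGroup.induction_on with
  | H g => exact ⟨Multiplicative.toAdd g, rfl⟩

/-- The circle metric between `a + ℤ` and `b + ℤ` is the distance from `a - b` to the nearest
integer. [folklore] -/
theorem circle_dist_circlePt (a b : ℝ) :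
    Nilmanifold.circle.dist (circlePt a) (circlePt b) = |a - b - round (a - b)| := by
  show Dist.dist ((a : ℝ) : AddCircle (1 : ℝ)) ((b : ℝ) : AddCircle (1 : ℝ)) = _
  rw [dist_eq_norm, ← AddCircle.coe_sub, AddCircle.norm_eq]
  simp

/-- **`cos(2π·)` is a `1`-bounded nilsequence generator on `ℝ/ℤ` with Lipschitz constant `2π`.**
[cite: GreenTao2010, §8 (the case `s = 1` of `GI(s)`)] -/
theorem isBoundedLipschitz_cosCircle : Nilmanifold.circle.IsBoundedLipschitz (2 * Real.pi) cosCircle := by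
  constructor
  · intro y
    obtain ⟨r, rfl⟩ := exists_eq_circlePt y
    rw [cosCircle_circlePt]
    exact Real.abs_cos_le_one _
  · intro y z
    obtain ⟨a, rfl⟩ := exists_eq_circlePt y
    obtain ⟨b, rfl⟩ := exists_eq_circlePt z
    rw [cosCircle_circlePt, cosCircle_circlePt, circle_dist_circlePt]
    set k : ℤ := round (a - b) with hk
    have hper : Real.cos (2 * Real.pi * b) = Real.cos (2 * Real.pi * (b + k)) := by
      rw [mul_add, show 2 * Real.pi * (k : ℝ) = (k : ℝ) * (2 * Real.pi) by ring,
        Real.cos_add_int_mul_two_pi]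
    rw [hper]
    refine (Real.abs_cos_sub_cos_le _ _).trans (le_of_eq ?_)
    rw [← mul_sub, abs_mul, abs_of_pos Real.two_pi_pos]
    congr 1
    ring_nf

/-- The rotation by `α` from the base point `x₀ + ℤ` generates the nilsequence `cos(2π(x₀ + nα))`.
[cite: GreenTao2010, §8] -/
theorem nilsequence_cosCircle (α x₀ : ℝ) (n : ℕ) :
    Nilmanifold.circle.nilsequence cosCircle (Multiplicative.ofAdd α) (circlePt x₀) n =
      Real.cos (2 * Real.pi * (x₀ + n * α)) := by
  rw [← cosCircle_circlePt]
  exact Nilmanifold.nilsequence_circle cosCircle α x₀ n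

/-- Sums against `f 1_{[N]}` on `ℤ_{N'}` are sums over `[N]` (`N < N'`). [folklore] -/
theorem sum_extendByZero_mul {N' : ℕ} [NeZero N'] {N : ℕ} (hNN' : N < N') (f : ℤ → ℝ)
    (φ : ZMod N' → ℂ) :
    ∑ x : ZMod N', (extendByZero N' N f x : ℂ) * φ x =
      ∑ n ∈ Finset.Icc 1 N, (f n : ℂ) * φ ((n : ℕ) : ZMod N') := by
  classical
  have hinj : Set.InjOn (fun n : ℕ => (n : ZMod N')) (Finset.Icc 1 N : Finset ℕ) := by
    intro a ha b hb hab
    have ha' := (Finset.mem_Icc.mp (Finset.mem_coe.mp ha)).2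
    have hb' := (Finset.mem_Icc.mp (Finset.mem_coe.mp hb)).2
    have := (ZMod.natCast_eq_natCast_iff' a b N').mp hab
    rwa [Nat.mod_eq_of_lt (by omega), Nat.mod_eq_of_lt (by omega)] at this
  rw [← Finset.sum_subset (Finset.subset_univ ((Finset.Icc 1 N).image fun n : ℕ => (n : ZMod N')))]
  · rw [Finset.sum_image hinj]
    refine Finset.sum_congr rfl fun n hn => ?_
    have hn' := Finset.mem_Icc.mp hn
    congr 2
    have := extendByZero_intCast (N' := N') hNN' f (v := (n : ℤ)) (by exact_mod_cast hn'.1)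
      (by exact_mod_cast hn'.2)
    rwa [Int.cast_natCast] at this
  · intro x _ hx
    have h0 : extendByZero N' N f x = 0 := by
      by_contra hne
      obtain ⟨h1, h2⟩ := extendByZero_ne_zero hne
      exact hx (Finset.mem_image.mpr ⟨x.val, Finset.mem_Icc.mpr ⟨h1, h2⟩, ZMod.natCast_zmod_val x⟩)
    rw [h0, Complex.ofReal_zero, zero_mul]

/-- **A large `U²(ℤ_M)` norm forces a large Fourier coefficient** (for `1`-bounded functions):
if `‖F‖_{U²}^4 > δ₀²` then `|F̂(ξ)| > δ₀` for some `ξ` (from `‖F‖_{U²}^4 ≤ (sup|F̂|)² 𝔼F²`).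
[cite: GreenTao2010, §8 ("The case `s = 1` is an exercise in harmonic analysis")] -/
theorem exists_dftCoeff_gt {M : ℕ} [NeZero M] {F : ZMod M → ℝ} (hF : ∀ x, |F x| ≤ 1) {δ₀ : ℝ}
    (h : δ₀ ^ 2 < gowersPower 2 F) : ∃ ξ : ZMod M, δ₀ < ‖dftCoeff F ξ‖ := by
  by_contra hall
  push Not at hall
  have h1 := gowersPower_two_le_of_dft F hall
  have h2 : (∑ x : ZMod M, F x ^ 2) / M ≤ 1 := by
    rw [div_le_one (by exact_mod_cast Nat.pos_of_ne_zero (NeZero.ne M))]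
    calc ∑ x : ZMod M, F x ^ 2 ≤ ∑ _x : ZMod M, (1 : ℝ) := Finset.sum_le_sum fun x _ => by
          rw [← sq_abs]; exact pow_le_one₀ (abs_nonneg _) (hF x)
      _ = M := by rw [Finset.sum_const, Finset.card_univ, ZMod.card, nsmul_eq_mul, mul_one]
  have : gowersPower 2 F ≤ δ₀ ^ 2 := h1.trans (by nlinarith [sq_nonneg δ₀])
  linarith

/-- **`GI(1)`: the inverse theorem for the `U²[N]` norm, as a datum** (Green–Tao 2010, Conj. 8.3 at `s = 1`:
"The case `s = 1` is an exercise in harmonic analysis. Indeed in this case one can take `G/Γ` to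
just be the standard unit circle `ℝ/ℤ`, so that `ℳ_{1,δ}` is a singleton set independent of
`δ`."). For `0 < δ ≤ 1`, `GreenTao2010_inverseConjectureAt 1 δ` holds with the family
`{ℝ/ℤ}` (`Nilmanifold.circle`), Lipschitz constant `2π`, and `c = δ²/32`: embed `[N]` in `ℤ_{2N}`
(Lemma B.5, `uniformityNorm_pow_le_gowersPower_extendByZero`: `‖f 1_{[N]}‖_{U²(ℤ_{2N})}^4 ≥ δ⁴/256`),
take a Fourier coefficient with `|f̂(ξ)| > δ²/32` (`exists_dftCoeff_gt`, from
`‖·‖_{U²}^4 = ∑|f̂|⁴`), so that `|∑_{n ≤ N} f(n) e(-nξ/2N)| > δ²N/16`, and correlate `f` with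
`cos(2πnα)` or `sin(2πnα) = cos(2π(nα - ¼))`, `α = ξ/2N` — rotation nilsequences on `ℝ/ℤ`
(`nilsequence_cosCircle`). [cite: GreenTao2010, Conj. 8.3 and the following paragraph (the case
`s = 1`)] -/
theorem GreenTao2010_inverseDatum_one {δ : ℝ} (hδ : 0 < δ) :
    GreenTao2010_inverseDatum 1 δ (fun _ : Fin 1 => Nilmanifold.circle) (2 * Real.pi) (δ ^ 2 / 32) := by
  refine ⟨by positivity, ?_⟩
  intro N hN f hf1 hδf
  -- embed `[N]` in `ℤ_{2N}`
  haveI : NeZero (2 * N) := ⟨by omega⟩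
  have hNN' : N < 2 * N := by omega
  have hB5 := uniformityNorm_pow_le_gowersPower_extendByZero (N' := 2 * N) (k := 2) (by norm_num) hN
    le_rfl (C' := 2) (by push_cast; linarith) f
  set Ff : ZMod (2 * N) → ℝ := extendByZero (2 * N) N f with hFf
  have hFf1 : ∀ x, |Ff x| ≤ 1 := by
    intro x
    have h := abs_extendByZero_le (N' := 2 * N) (N := N) (f := f) (g := fun _ : ℤ => (1 : ℝ))
      (fun x _ _ => hf1 x) x
    refine h.trans ?_
    unfold extendByZero
    split_ifs <;> norm_num
  have hgp : δ ^ 4 / 256 ≤ gowersPower 2 Ff := by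
    have h2 : δ ^ 4 ≤ uniformityNorm 2 N (fun n => ((f n : ℝ) : ℂ)) ^ 4 := by
      have := pow_le_pow_left₀ hδ.le hδf 4
      simpa using this
    have h3 : uniformityNorm 2 N (fun n => ((f n : ℝ) : ℂ)) ^ (2 ^ 2) ≤
        2 * (2 * (2 : ℕ)) ^ 2 * (2 : ℝ) ^ (2 + 1) * gowersPower 2 Ff := hB5
    norm_num at h3
    rw [div_le_iff₀ (by norm_num)]
    linarith
  -- a large Fourier coefficient
  obtain ⟨ξ, hξ⟩ := exists_dftCoeff_gt hFf1 (δ₀ := δ ^ 2 / 32) (by nlinarith [pow_pos hδ 4])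
  set α : ℝ := (ξ.val : ℝ) / (2 * N : ℕ) with hα
  -- the exponential sum over `[N]`
  set S : ℂ := ∑ n ∈ Finset.Icc 1 N, (f n : ℂ) * Complex.exp (((-(2 * Real.pi * (n * α)) : ℝ) : ℂ) * Complex.I)
    with hS
  have hdft : dftCoeff Ff ξ = S / (2 * N : ℕ) := by
    unfold dftCoeff
    congr 1
    rw [sum_extendByZero_mul hNN' f]
    refine Finset.sum_congr rfl fun n _ => ?_
    congr 1
    have hneg : -(((n : ℕ) : ZMod (2 * N)) * ξ) = ((-((n : ℤ) * (ξ.val : ℕ)) : ℤ) : ZMod (2 * N)) := by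
      push_cast
      rw [ZMod.natCast_zmod_val]
    rw [hneg, ZMod.stdAddChar_coe]
    congr 1
    rw [hα]
    push_cast
    field_simp
  have hSnorm : δ ^ 2 / 32 * (2 * N : ℕ) < ‖S‖ := by
    have h2N : (0 : ℝ) < (2 * N : ℕ) := by exact_mod_cast (show 0 < 2 * N by omega)
    rw [hdft, norm_div, Complex.norm_natCast, lt_div_iff₀ h2N] at hξ
    exact hξ
  -- real and imaginary parts: cosine and sine sums
  have hre : S.re = ∑ n ∈ Finset.Icc 1 N, f n * Real.cos (2 * Real.pi * (n * α)) := by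
    rw [hS, Complex.re_sum]
    refine Finset.sum_congr rfl fun n _ => ?_
    rw [Complex.re_ofReal_mul, Complex.exp_ofReal_mul_I_re, Real.cos_neg]
  have him : S.im = -∑ n ∈ Finset.Icc 1 N, f n * Real.sin (2 * Real.pi * (n * α)) := by
    rw [hS, Complex.im_sum, ← Finset.sum_neg_distrib]
    refine Finset.sum_congr rfl fun n _ => ?_
    rw [Complex.im_ofReal_mul, Complex.exp_ofReal_mul_I_im, Real.sin_neg, mul_neg]
  have hNpos : (0 : ℝ) < N := by exact_mod_cast hN
  have hsplit : δ ^ 2 / 32 * (2 * N : ℕ) < |S.re| + |S.im| :=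
    hSnorm.trans_le (Complex.norm_le_abs_re_add_abs_im S)
  -- orbit averages of the two rotations
  have hcos : Nilmanifold.circle.orbitAverage N (fun n => f n) cosCircle (Multiplicative.ofAdd α)
      (circlePt 0) = S.re / N := by
    rw [Nilmanifold.orbitAverage_eq_sum_nilsequence, hre]
    congr 1
    refine Finset.sum_congr rfl fun n _ => ?_
    rw [nilsequence_cosCircle, zero_add]
  have hsin : Nilmanifold.circle.orbitAverage N (fun n => f n) cosCircle (Multiplicative.ofAdd α)
      (circlePt (-(1 / 4 : ℝ))) = -S.im / N := by
    rw [Nilmanifold.orbitAverage_eq_sum_nilsequence, him, neg_neg]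
    congr 1
    refine Finset.sum_congr rfl fun n _ => ?_
    rw [nilsequence_cosCircle]
    congr 1
    rw [show 2 * Real.pi * (-(1 / 4) + n * α) = 2 * Real.pi * (n * α) - Real.pi / 2 by ring,
      Real.cos_sub_pi_div_two]
  rcases le_or_gt (δ ^ 2 / 32 * N) |S.re| with h | h
  · refine ⟨0, Multiplicative.ofAdd α, circlePt 0, cosCircle, isBoundedLipschitz_cosCircle, ?_⟩
    rw [hcos, abs_div, Nat.abs_cast, le_div_iff₀ hNpos]
    exact h
  · have h' : δ ^ 2 / 32 * N ≤ |S.im| := by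
      push_cast at hsplit
      linarith
    refine ⟨0, Multiplicative.ofAdd α, circlePt (-(1 / 4 : ℝ)), cosCircle, isBoundedLipschitz_cosCircle, ?_⟩
    rw [hsin, abs_div, abs_neg, Nat.abs_cast, le_div_iff₀ hNpos]
    exact h'

/-- **`GI(1)`** in the form of Conj. 8.3: `GreenTao2010_inverseConjectureAt 1 δ` for every `δ > 0`.
[cite: GreenTao2010, Conj. 8.3 and the following paragraph (the case `s = 1`)] -/
theorem GreenTao2010_inverseConjectureAt_one {δ : ℝ} (hδ : 0 < δ) :
    GreenTao2010_inverseConjectureAt 1 δ :=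
  ⟨1, fun _ => Nilmanifold.circle, 2 * Real.pi, δ ^ 2 / 32, GreenTao2010_inverseDatum_one hδ⟩

/-- **Prop. 10.1 at `s = 1` from Cor. 11.6 for the circle alone**: since the `GI(1)` family is
`{ℝ/ℤ}` with Lipschitz bound `2π`, the relative inverse theorem at level `1` needs "nilsequences
obstruct uniformity, II" only for `2π`-Lipschitz `1`-bounded functions on `ℝ/ℤ`.
[cite: GreenTao2010, Prop. 10.1, Conj. 8.3 (the case `s = 1`), Cor. 11.6] -/
theorem GreenTao2010_relativeInverseAt_one_of
    (hNG : GreenTao2010_nilObstructionAt 1 Nilmanifold.circle (2 * Real.pi)) {δ C : ℝ} (hδ : 0 < δ)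
    (hC : 20 ≤ C) (A : ℕ → ℝ → ℝ) :
    ∃ η : ℝ, GreenTao2010_relativeInverseDatum 1 δ C A (fun _ : Fin 1 => Nilmanifold.circle)
      (2 * Real.pi) (relInvParam 1 C δ ^ 2 / 32 / 2) η 1 :=
  GreenTao2010_relativeInverseDatum_of_inverseDatum le_rfl hδ hC A
    (GreenTao2010_inverseDatum_one (relInvParam_pos 1 (by linarith) hδ)) fun _ => hNG

end inverseU2

end Literature.NumberTheory.Sieve

namespace Literature.NumberTheory.Sieve

/-- **Thm. 7.2 at level `s = 1` from Cor. 11.6 and Prop. 10.2 for the circle alone**: `GI(1)`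
being proved with the family `{ℝ/ℤ}` and Lipschitz bound `2π`, Prop. 10.1 at `s = 1` holds with that
family (`GreenTao2010_relativeInverseAt_one_of`), and the §10 assembly
(`GreenTao2010_gowersUniformityAt_of_local`, with Prop. 6.4 proved) needs Prop. 10.2 only for its
members. So the `U²`-uniformity of `Λ'_{b,W} - 1` (which controls all systems of complexity `1`)
follows from the two classical circle statements: "nilsequences obstruct uniformity, II" and
"`Λ'_{b,W} - 1` is orthogonal to nilsequences", both for `2π`-Lipschitz `1`-bounded `F : ℝ/ℤ → ℝ`
(i.e. for the sequences `F(x₀ + nα)`). [cite: GreenTao2010, Thm. 7.2, §10, Conj. 8.3 (the case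
`s = 1`), Cor. 11.6, Prop. 10.2] -/
theorem GreenTao2010_gowersUniformityAt_one_of_circle
    (hNG : GreenTao2010_nilObstructionAt 1 Nilmanifold.circle (2 * Real.pi))
    (h102 : GreenTao2010_nilsequenceOrthogonalityAt 1 Nilmanifold.circle (2 * Real.pi)) :
    GreenTao2010_gowersUniformityAt 1 :=
  GreenTao2010_gowersUniformityAt_of_local le_rfl GreenTao2010_pseudorandomDomination_holds
    fun _δ hδ _ _C hC A => by
      obtain ⟨η, hd⟩ := GreenTao2010_relativeInverseAt_one_of hNG hδ hC A
      exact ⟨1, fun _ => Nilmanifold.circle, 2 * Real.pi, _, η, 1, hd, fun _ => h102⟩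

/-- **Thm. 7.2 at level `s = 1` from Cor. 11.6 and Prop. 10.2 at `s = 1`** (the unlocalised
form). [cite: GreenTao2010, Thm. 7.2, §10, Conj. 8.3 (the case `s = 1`), Cor. 11.6, Prop. 10.2] -/
theorem GreenTao2010_gowersUniformityAt_one_of
    (hNG : ∀ (X : Nilmanifold 1) (M : ℝ), GreenTao2010_nilObstructionAt 1 X M)
    (h102 : ∀ (X : Nilmanifold 1) (M : ℝ), GreenTao2010_nilsequenceOrthogonalityAt 1 X M) :
    GreenTao2010_gowersUniformityAt 1 :=
  GreenTao2010_gowersUniformityAt_one_of_circle (hNG _ _) (h102 _ _)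

end Literature.NumberTheory.Sieve
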